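import Literature.NumberTheory.Sieve.CFSemigroupLipRPF
import HarnessLib

/-!
# The spectral gap of `L_δ` on the Lipschitz space: `L_δ = Π + Q`, `‖Qⁿ‖ ≤ C ρⁿ`

Support file (all results proved) for the named fact
`Literature.NumberTheory.Sieve.MageeOhWinter2019_uniformCounting` (`CFSemigroupCounting.lean`).
[MageeOhWinter2019, Thm. 10 (3)]: apart from the simple leading eigenvalue, the spectrum of the
transfer operator on the space of regular functions lies in a disc of strictly smaller radius. At
`s = δ_A` (leading eigenvalue `1`, spectral projection `Π = h ⊗ ν`, `CFSemigroupLipRPF.lean`) we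
prove this on the Lipschitz Banach space `CfLip` in operator-norm form:

* `norm_cfLOp_pow_sub_cfPi_le`: `‖L_δⁿ - Π‖ ≤ C ρⁿ` with explicit `C = cfGapB A hA h2` and
  `ρ = cfRho A = max(θ(δ)^{1/2}, 2^{-1/2}) < 1` (sup-norm convergence of `CFSemigroupSpectralGap`
  for `L_δ^{⌈n/2⌉}` combined with the Lasota–Yorke inequality for `L_δ^{⌊n/2⌋}`);
* `cfQδ = L_δ - Π`, `cfQδ_pow : Qⁿ = L_δⁿ - Π` (`n ≥ 1`), `norm_cfQδ_pow_le`, `summable_cfQδ_pow`;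
* `cfR0 = Σ Qⁿ`, the inverse of `1 - Q` (`one_sub_cfQδ_mul_cfR0`, `cfR0_mul_one_sub_cfQδ`,
  `isUnit_one_sub_cfQδ`), with `ν ∘ R₀ = ν` (`cfNuL_cfR0`) and `R₀ h = h` (`cfR0_cfHL`).

## References

* M. Magee, H. Oh, D. Winter, J. reine angew. Math. 753 (2019) 89–135, Thm. 10 (3).
  [MageeOhWinter2019]
-/

noncomputable section

open Set Filter MeasureTheory
open scoped Topology

namespace Literature.NumberTheory.Sieve

variable {A : Finset ℕ}

/-! ### The contraction rate `ρ` -/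

variable (A) in
/-- The contraction rate `ρ = max(θ(δ_A)^{1/2}, 2^{-1/2})` of `L_δⁿ - Π` on the Lipschitz space.
[folklore] -/
def cfRho : ℝ := max (Real.sqrt (cfTheta (cfDimension A))) (Real.sqrt (1 / 2))

/-- `ρ > 0`. [folklore] -/
theorem cfRho_pos : 0 < cfRho A :=
  lt_max_of_lt_right (Real.sqrt_pos.2 (by norm_num))

/-- `ρ < 1`. [folklore] -/
theorem cfRho_lt_one (hA : ∀ a ∈ A, 1 ≤ a) (h2 : 2 ≤ A.card) : cfRho A < 1 := by
  have hθ := cfTheta_lt_one (cfDimension_pos hA h2).le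
  have hθ0 := (cfTheta_pos (cfDimension_pos hA h2).le).le
  refine max_lt ?_ ?_
  · rw [Real.sqrt_lt' one_pos, one_pow]; exact hθ
  · rw [Real.sqrt_lt' one_pos, one_pow]; norm_num

/-- `ρ ≤ 1`. [folklore] -/
theorem cfRho_le_one (hA : ∀ a ∈ A, 1 ≤ a) (h2 : 2 ≤ A.card) : cfRho A ≤ 1 := (cfRho_lt_one hA h2).le

/-- `θ(δ)^{m'} ≤ ρⁿ` when `n ≤ 2 m'`. [folklore] -/
theorem cfTheta_pow_le_cfRho_pow (hA : ∀ a ∈ A, 1 ≤ a) (h2 : 2 ≤ A.card) {n m' : ℕ} (h : n ≤ 2 * m') :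
    cfTheta (cfDimension A) ^ m' ≤ cfRho A ^ n := by
  have hθ0 := (cfTheta_pos (cfDimension_pos hA h2).le).le
  have hρ0 := (cfRho_pos (A := A)).le
  have hρ1 := cfRho_le_one hA h2
  calc cfTheta (cfDimension A) ^ m' = (Real.sqrt (cfTheta (cfDimension A)) ^ 2) ^ m' := by
        rw [Real.sq_sqrt hθ0]
    _ = Real.sqrt (cfTheta (cfDimension A)) ^ (2 * m') := by rw [pow_mul]
    _ ≤ cfRho A ^ (2 * m') := pow_le_pow_left₀ (Real.sqrt_nonneg _) (le_max_left _ _) _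
    _ ≤ cfRho A ^ n := pow_le_pow_of_le_one hρ0 hρ1 h

/-- `(1/2)^{m-1} ≤ 2 ρⁿ / ρ` when `n ≤ 2m + 1`. [folklore] -/
theorem half_pow_le_cfRho_pow (hA : ∀ a ∈ A, 1 ≤ a) (h2 : 2 ≤ A.card) {n m : ℕ} (h : n ≤ 2 * m + 1) :
    (1 / 2 : ℝ) ^ (m - 1) ≤ 2 * cfRho A ^ n / cfRho A := by
  have hρ := cfRho_pos (A := A)
  have hρ1 := cfRho_le_one hA h2
  have h1 : (1 / 2 : ℝ) ^ (m - 1) ≤ 2 * (1 / 2 : ℝ) ^ m := by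
    rcases m with _ | k
    · norm_num
    · rw [Nat.add_sub_cancel, pow_succ]; linarith [pow_pos (by norm_num : (0 : ℝ) < 1 / 2) k]
  have h2' : (1 / 2 : ℝ) ^ m ≤ cfRho A ^ (2 * m) := by
    calc (1 / 2 : ℝ) ^ m = (Real.sqrt (1 / 2) ^ 2) ^ m := by rw [Real.sq_sqrt (by norm_num)]
      _ = Real.sqrt (1 / 2) ^ (2 * m) := by rw [pow_mul]
      _ ≤ cfRho A ^ (2 * m) := pow_le_pow_left₀ (Real.sqrt_nonneg _) (le_max_right _ _) _
  have h3 : cfRho A ^ (2 * m) * cfRho A ≤ cfRho A ^ n := by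
    rw [← pow_succ]
    exact pow_le_pow_of_le_one hρ.le hρ1 h
  rw [le_div_iff₀ hρ]
  nlinarith [pow_nonneg hρ.le (2 * m)]

/-! ### The operator-norm spectral gap -/

section Gap

variable (A) (hA : ∀ a ∈ A, 1 ≤ a) (h2 : 2 ≤ A.card)
include hA h2

/-- `‖(δ : ℂ)‖ = δ` and `Re δ = δ`. [folklore] -/
theorem norm_ofReal_cfDimension : ‖((cfDimension A : ℝ) : ℂ)‖ = cfDimension A ∧
    ((cfDimension A : ℝ) : ℂ).re = cfDimension A := by
  refine ⟨?_, Complex.ofReal_re _⟩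
  rw [Complex.norm_real, Real.norm_eq_abs, abs_of_nonneg (cfDimension_pos hA h2).le]

/-- **Uniform bound for the powers of `L_δ`:** `‖L_δⁿ‖ ≤ K₁ = 4^δ (3 + 2δ e^{2δ})`.
[cite: MageeOhWinter2019, Thm. 10] -/
theorem norm_cfLOp_pow_le_unif (n : ℕ) :
    ‖cfLOp A hA (cfDimension A : ℂ) ^ n‖ ≤
      (4 : ℝ) ^ cfDimension A * (3 + 2 * cfDimension A * Real.exp (2 * cfDimension A)) := by
  obtain ⟨hn, hre⟩ := norm_ofReal_cfDimension A hA h2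
  have h := norm_cfLOp_pow_le A hA (nonempty_of_two_le_card h2) (s := (cfDimension A : ℂ))
    (by rw [hre]; exact (cfDimension_pos hA h2).le) n
  rwa [hre, hn, cfEig_cfDimension hA h2, one_pow, mul_one] at h

/-- Sup bound for the iterates at `s = δ`: `‖L_δ^m f (x)‖ ≤ M 4^δ` if `‖f‖ ≤ M` on `[0,1]`.
[cite: MageeOhWinter2019, §3.3] -/
theorem norm_cfLC_iterate_delta_le (m : ℕ) {f : ℝ → ℂ} {M : ℝ} (hM0 : 0 ≤ M)
    (hM : ∀ y ∈ Icc (0 : ℝ) 1, ‖f y‖ ≤ M) {x : ℝ} (hx : x ∈ Icc (0 : ℝ) 1) :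
    ‖(cfLC A (cfDimension A : ℂ))^[m] f x‖ ≤ M * (4 : ℝ) ^ cfDimension A := by
  obtain ⟨-, hre⟩ := norm_ofReal_cfDimension A hA h2
  have h := norm_cfLC_iterate_le_of_bound hA (nonempty_of_two_le_card h2) (s := (cfDimension A : ℂ))
    (by rw [hre]; exact (cfDimension_pos hA h2).le) m hM0 hM hx
  rw [hre, cfEig_cfDimension hA h2, one_pow, mul_one] at h
  exact h

/-- Lasota–Yorke at `s = δ`: `‖L_δ^m f (x) - L_δ^m f (y)‖ ≤ 4^δ (2δ e^{2δ} M + 2^{1-m} L) |x - y|`.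
[cite: MageeOhWinter2019, §3.3] -/
theorem norm_cfLC_iterate_delta_sub_le (m : ℕ) {f : ℝ → ℂ} {M L : ℝ} (hM0 : 0 ≤ M) (hL0 : 0 ≤ L)
    (hM : ∀ y ∈ Icc (0 : ℝ) 1, ‖f y‖ ≤ M)
    (hL : ∀ x ∈ Icc (0 : ℝ) 1, ∀ y ∈ Icc (0 : ℝ) 1, ‖f x - f y‖ ≤ L * |x - y|) {x y : ℝ}
    (hx : x ∈ Icc (0 : ℝ) 1) (hy : y ∈ Icc (0 : ℝ) 1) :
    ‖(cfLC A (cfDimension A : ℂ))^[m] f x - (cfLC A (cfDimension A : ℂ))^[m] f y‖ ≤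
      (4 : ℝ) ^ cfDimension A *
        ((2 * cfDimension A * Real.exp (2 * cfDimension A) * M + (1 / 2 : ℝ) ^ (m - 1) * L) * |x - y|) := by
  obtain ⟨hn, hre⟩ := norm_ofReal_cfDimension A hA h2
  have h := norm_cfLC_iterate_sub_le' hA (nonempty_of_two_le_card h2) (s := (cfDimension A : ℂ))
    (by rw [hre]; exact (cfDimension_pos hA h2).le) m hM0 hL0 hM hL hx hy
  rw [hre, hn, cfEig_cfDimension hA h2, one_pow, mul_one] at h
  exact h

/-- The explicit constant of the spectral gap estimate. [folklore] -/
def cfGapB : ℝ :=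
  (4 : ℝ) ^ cfDimension A / cfRho A *
    ((1 + 2 * cfDimension A * Real.exp (2 * cfDimension A)) * (4 * cfGapConst (cfDimension A)) +
      2 * ((4 : ℝ) ^ cfDimension A * (3 + 2 * cfDimension A * Real.exp (2 * cfDimension A)) + ‖cfHL A hA h2‖))

/-- `cfGapB ≥ 0`. [folklore] -/
theorem cfGapB_nonneg : 0 ≤ cfGapB A hA h2 := by
  unfold cfGapB
  have := cfRho_pos (A := A)
  have := (cfGapConst_pos (cfDimension_pos hA h2).le).le
  have := (cfDimension_pos hA h2).le
  positivity

/-- **Spectral gap in operator norm** ([MageeOhWinter2019, Thm. 10 (3)] at `s = δ_A` on the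
Lipschitz space): `‖L_δⁿ - Π‖ ≤ C ρⁿ` with `ρ = cfRho A < 1`, `C = cfGapB A hA h2`.
[cite: MageeOhWinter2019, Thm. 10] -/
theorem norm_cfLOp_pow_sub_cfPi_le (n : ℕ) :
    ‖cfLOp A hA (cfDimension A : ℂ) ^ n - cfPi A hA h2‖ ≤ cfGapB A hA h2 * cfRho A ^ n := by
  set δ := cfDimension A with hδ
  set T := cfLOp A hA (δ : ℂ) with hT
  set P := cfPi A hA h2 with hP
  have hδ0 : 0 ≤ δ := (cfDimension_pos hA h2).le
  obtain ⟨hnorm, hre⟩ := norm_ofReal_cfDimension A hA h2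
  have hρ := cfRho_pos (A := A)
  have hρ1 := cfRho_le_one hA h2
  have hC := (cfGapConst_pos (s := δ) hδ0).le
  have hθ0 := (cfTheta_pos (s := δ) hδ0).le
  -- split `n = m + m'`
  set m := n / 2 with hm
  set m' := n - n / 2 with hm'
  have hnm : n = m + m' := by omega
  have hm'2 : n ≤ 2 * m' := by omega
  have hm2 : n ≤ 2 * m + 1 := by omega
  -- `T^n - P = T^m (T^{m'} - P)`
  have hsplit : T ^ n - P = T ^ m * (T ^ m' - P) := by
    rw [mul_sub, ← pow_add, ← hnm, hT, hP, cfLOp_pow_mul_cfPi]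
  have hK1 := norm_cfLOp_pow_le_unif A hA h2 m'
  set K₁ := (4 : ℝ) ^ δ * (3 + 2 * δ * Real.exp (2 * δ)) with hK₁
  have hK10 : 0 ≤ K₁ := by rw [hK₁]; positivity
  have hPi := norm_cfPi_le A hA h2
  rw [hsplit]
  refine ContinuousLinearMap.opNorm_le_bound _ (mul_nonneg (cfGapB_nonneg A hA h2) (pow_nonneg hρ.le n))
    fun F => ?_
  set G := (T ^ m' - P) F with hG
  -- bounds on `G`
  have hGsup : ∀ y ∈ Icc (0 : ℝ) 1, ‖G.extend y‖ ≤ 4 * cfGapConst δ * cfTheta δ ^ m' * ‖F‖ := by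
    intro y hy
    rw [CfLip.extend_of_mem _ hy, hG]
    have h := norm_cfLOp_pow_apply_sub_le A hA h2 F m' ⟨y, hy⟩
    rwa [← CfLip.sub_apply] at h
  have hGnorm : ‖G‖ ≤ (K₁ + ‖cfHL A hA h2‖) * ‖F‖ := by
    rw [hG]
    calc ‖(T ^ m' - P) F‖ ≤ ‖T ^ m' - P‖ * ‖F‖ := ContinuousLinearMap.le_opNorm _ _
      _ ≤ (‖T ^ m'‖ + ‖P‖) * ‖F‖ := mul_le_mul_of_nonneg_right (norm_sub_le _ _) (norm_nonneg _)
      _ ≤ (K₁ + ‖cfHL A hA h2‖) * ‖F‖ := mul_le_mul_of_nonneg_right (add_le_add hK1 hPi) (norm_nonneg _)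
  set MG := 4 * cfGapConst δ * cfTheta δ ^ m' * ‖F‖ with hMG
  have hMG0 : 0 ≤ MG := by rw [hMG]; positivity
  -- the value `T^m G`
  have hval : ∀ x : Icc (0 : ℝ) 1, (T ^ m * (T ^ m' - P)) F x = (cfLC A (δ : ℂ))^[m] G.extend x := by
    intro x
    rw [ContinuousLinearMap.mul_def, ContinuousLinearMap.coe_comp, Function.comp_apply, ← hG, hT,
      cfLOp_pow_apply]
  have hsup : ∀ x : Icc (0 : ℝ) 1, ‖(T ^ m * (T ^ m' - P)) F x‖ ≤ MG * (4 : ℝ) ^ δ := by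
    intro x
    rw [hval]
    exact norm_cfLC_iterate_delta_le A hA h2 m hMG0 hGsup x.2
  have hlip : ∀ x y : Icc (0 : ℝ) 1, ‖(T ^ m * (T ^ m' - P)) F x - (T ^ m * (T ^ m' - P)) F y‖ ≤
      (4 : ℝ) ^ δ * (2 * δ * Real.exp (2 * δ) * MG + (1 / 2 : ℝ) ^ (m - 1) * ((K₁ + ‖cfHL A hA h2‖) * ‖F‖)) *
        |(x : ℝ) - y| := by
    intro x y
    rw [hval, hval, mul_assoc]
    have h := norm_cfLC_iterate_delta_sub_le A hA h2 m (f := G.extend) (M := MG) (L := ‖G‖) hMG0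
      (norm_nonneg G) hGsup (fun x hx y hy => G.norm_extend_sub_le hx hy) x.2 y.2
    refine h.trans (mul_le_mul_of_nonneg_left ?_ (by positivity))
    refine mul_le_mul_of_nonneg_right ?_ (abs_nonneg _)
    gcongr
  have hbound := CfLip.norm_le_of_bounds (by positivity) hsup hlip
  refine hbound.trans ?_
  -- convert to `ρⁿ`
  have hθm' : cfTheta δ ^ m' ≤ cfRho A ^ n := cfTheta_pow_le_cfRho_pow hA h2 hm'2
  have hhalf : (1 / 2 : ℝ) ^ (m - 1) ≤ 2 * cfRho A ^ n / cfRho A := half_pow_le_cfRho_pow hA h2 hm2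
  have hρn : cfRho A ^ n ≤ cfRho A ^ n / cfRho A := by
    rw [le_div_iff₀ hρ]; exact mul_le_of_le_one_right (pow_nonneg hρ.le n) hρ1
  have hF := norm_nonneg F
  have hKh : 0 ≤ K₁ + ‖cfHL A hA h2‖ := by positivity
  have e1 : MG ≤ 4 * cfGapConst δ * (cfRho A ^ n / cfRho A) * ‖F‖ := by
    rw [hMG]; gcongr; exact hθm'.trans hρn
  have e2 : (1 / 2 : ℝ) ^ (m - 1) * ((K₁ + ‖cfHL A hA h2‖) * ‖F‖) ≤
      (2 * cfRho A ^ n / cfRho A) * ((K₁ + ‖cfHL A hA h2‖) * ‖F‖) :=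
    mul_le_mul_of_nonneg_right hhalf (by positivity)
  have h4 : 0 ≤ (4 : ℝ) ^ δ := by positivity
  have hexp : 0 ≤ 2 * δ * Real.exp (2 * δ) := by positivity
  calc MG * (4 : ℝ) ^ δ +
        (4 : ℝ) ^ δ * (2 * δ * Real.exp (2 * δ) * MG + (1 / 2 : ℝ) ^ (m - 1) * ((K₁ + ‖cfHL A hA h2‖) * ‖F‖))
      ≤ (4 * cfGapConst δ * (cfRho A ^ n / cfRho A) * ‖F‖) * (4 : ℝ) ^ δ +
          (4 : ℝ) ^ δ * (2 * δ * Real.exp (2 * δ) * (4 * cfGapConst δ * (cfRho A ^ n / cfRho A) * ‖F‖) +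
            (2 * cfRho A ^ n / cfRho A) * ((K₁ + ‖cfHL A hA h2‖) * ‖F‖)) := by
        gcongr
    _ = cfGapB A hA h2 * cfRho A ^ n * ‖F‖ := by
        rw [cfGapB, hK₁]
        field_simp
        ring

/-! ### `Q = L_δ - Π` and the Neumann inverse of `1 - Q` -/

/-- **The quasi-compact remainder `Q = L_δ - Π`.** [cite: MageeOhWinter2019, Thm. 10] -/
def cfQδ : CfLip →L[ℂ] CfLip := cfLOp A hA (cfDimension A : ℂ) - cfPi A hA h2

/-- `Qⁿ = L_δⁿ - Π` for `n ≥ 1` (`Π L = L Π = Π`, `Π² = Π`). [cite: MageeOhWinter2019, Thm. 10] -/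
theorem cfQδ_pow : ∀ n : ℕ, 1 ≤ n → cfQδ A hA h2 ^ n = cfLOp A hA (cfDimension A : ℂ) ^ n - cfPi A hA h2
  | 0, h => absurd h (by norm_num)
  | 1, _ => by rw [pow_one, pow_one, cfQδ]
  | n + 2, _ => by
      have ih := cfQδ_pow (n + 1) (by omega)
      rw [pow_succ, ih, cfQδ, sub_mul, mul_sub, mul_sub, ← pow_succ, cfLOp_pow_mul_cfPi, cfPi_mul_cfLOp,
        cfPi_mul_cfPi]
      abel

/-- **Norms of the powers of `Q`:** `‖Qⁿ‖ ≤ max(1, C) ρⁿ`. [cite: MageeOhWinter2019, Thm. 10] -/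
theorem norm_cfQδ_pow_le (n : ℕ) : ‖cfQδ A hA h2 ^ n‖ ≤ max 1 (cfGapB A hA h2) * cfRho A ^ n := by
  rcases Nat.eq_zero_or_pos n with rfl | hn
  · rw [pow_zero, pow_zero, mul_one, ContinuousLinearMap.one_def]
    exact ContinuousLinearMap.norm_id_le.trans (le_max_left _ _)
  · rw [cfQδ_pow A hA h2 n hn]
    exact (norm_cfLOp_pow_sub_cfPi_le A hA h2 n).trans
      (mul_le_mul_of_nonneg_right (le_max_right _ _) (pow_nonneg (cfRho_pos (A := A)).le n))

/-- **Summability of the powers of `Q`** (in operator norm). [cite: MageeOhWinter2019, Thm. 10] -/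
theorem summable_cfQδ_pow : Summable fun n : ℕ => cfQδ A hA h2 ^ n := by
  refine Summable.of_norm_bounded (g := fun n : ℕ => max 1 (cfGapB A hA h2) * cfRho A ^ n) ?_
    (norm_cfQδ_pow_le A hA h2)
  exact (summable_geometric_of_lt_one (cfRho_pos (A := A)).le (cfRho_lt_one hA h2)).mul_left _

/-- **The Neumann series `R₀ = Σ Qⁿ`.** [folklore] -/
def cfR0 : CfLip →L[ℂ] CfLip := ∑' n : ℕ, cfQδ A hA h2 ^ n

/-- `R₀ = 1 + Q R₀`. [folklore] -/
theorem cfR0_eq_one_add : cfR0 A hA h2 = 1 + cfQδ A hA h2 * cfR0 A hA h2 := by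
  have h := (summable_cfQδ_pow A hA h2).tsum_eq_zero_add
  rw [pow_zero] at h
  have h' : ∑' n : ℕ, cfQδ A hA h2 ^ (n + 1) = cfQδ A hA h2 * ∑' n : ℕ, cfQδ A hA h2 ^ n := by
    simp_rw [pow_succ']
    exact (summable_cfQδ_pow A hA h2).tsum_mul_left _
  rw [h'] at h
  exact h

/-- `R₀ = 1 + R₀ Q`. [folklore] -/
theorem cfR0_eq_one_add' : cfR0 A hA h2 = 1 + cfR0 A hA h2 * cfQδ A hA h2 := by
  have h := (summable_cfQδ_pow A hA h2).tsum_eq_zero_add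
  rw [pow_zero] at h
  have h' : ∑' n : ℕ, cfQδ A hA h2 ^ (n + 1) = (∑' n : ℕ, cfQδ A hA h2 ^ n) * cfQδ A hA h2 := by
    simp_rw [pow_succ]
    exact (summable_cfQδ_pow A hA h2).tsum_mul_right _
  rw [h'] at h
  exact h

/-- `(1 - Q) R₀ = 1`. [folklore] -/
theorem one_sub_cfQδ_mul_cfR0 : (1 - cfQδ A hA h2) * cfR0 A hA h2 = 1 := by
  have h := cfR0_eq_one_add A hA h2
  rw [sub_mul, one_mul]
  nth_rewrite 1 [h]
  exact add_sub_cancel_right _ _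

/-- `R₀ (1 - Q) = 1`. [folklore] -/
theorem cfR0_mul_one_sub_cfQδ : cfR0 A hA h2 * (1 - cfQδ A hA h2) = 1 := by
  have h := cfR0_eq_one_add' A hA h2
  rw [mul_sub, mul_one]
  nth_rewrite 1 [h]
  exact add_sub_cancel_right _ _

/-- **`1 - Q` is invertible** with inverse `R₀ = Σ Qⁿ` (as a unit of the operator algebra).
[cite: MageeOhWinter2019, Thm. 10] -/
def cfOneSubQUnit : (CfLip →L[ℂ] CfLip)ˣ :=
  ⟨1 - cfQδ A hA h2, cfR0 A hA h2, one_sub_cfQδ_mul_cfR0 A hA h2, cfR0_mul_one_sub_cfQδ A hA h2⟩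

/-- `1 - Q` is a unit. [cite: MageeOhWinter2019, Thm. 10] -/
theorem isUnit_one_sub_cfQδ : IsUnit (1 - cfQδ A hA h2) := ⟨cfOneSubQUnit A hA h2, rfl⟩

/-- `Ring.inverse (1 - Q) = R₀`. [folklore] -/
theorem ringInverse_one_sub_cfQδ : Ring.inverse (1 - cfQδ A hA h2) = cfR0 A hA h2 := by
  rw [show (1 - cfQδ A hA h2) = ((cfOneSubQUnit A hA h2 : (CfLip →L[ℂ] CfLip)ˣ) : CfLip →L[ℂ] CfLip)
    from rfl, Ring.inverse_unit]
  rfl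

/-! ### `ν` and `h` versus `Q` and `R₀` -/

/-- `ν ∘ Q = 0`. [folklore] -/
theorem cfNuL_cfQδ (F : CfLip) : cfNuL A hA h2 (cfQδ A hA h2 F) = 0 := by
  show cfNuL A hA h2 (cfLOp A hA (cfDimension A : ℂ) F - cfPi A hA h2 F) = 0
  rw [map_sub, cfNuL_cfLOp, cfPi_apply, map_smul, cfNuL_cfHL, smul_eq_mul, mul_one, sub_self]

/-- `ν ∘ Qⁿ = 0` for `n ≥ 1`. [folklore] -/
theorem cfNuL_cfQδ_pow_succ (n : ℕ) (F : CfLip) : cfNuL A hA h2 ((cfQδ A hA h2 ^ (n + 1)) F) = 0 := by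
  rw [pow_succ']
  exact cfNuL_cfQδ A hA h2 _

/-- `Q h = 0`. [folklore] -/
theorem cfQδ_cfHL : cfQδ A hA h2 (cfHL A hA h2) = 0 := by
  show cfLOp A hA (cfDimension A : ℂ) (cfHL A hA h2) - cfPi A hA h2 (cfHL A hA h2) = 0
  rw [cfLOp_cfHL, cfPi_apply, cfNuL_cfHL, one_smul, sub_self]

/-- `Qⁿ h = 0` for `n ≥ 1`. [folklore] -/
theorem cfQδ_pow_succ_cfHL (n : ℕ) : (cfQδ A hA h2 ^ (n + 1)) (cfHL A hA h2) = 0 := by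
  rw [pow_succ]
  show (cfQδ A hA h2 ^ n) (cfQδ A hA h2 (cfHL A hA h2)) = 0
  rw [cfQδ_cfHL, map_zero]

/-- Pointwise form of the Neumann series. [folklore] -/
theorem cfR0_apply (F : CfLip) : cfR0 A hA h2 F = ∑' n : ℕ, (cfQδ A hA h2 ^ n) F := by
  have h := (ContinuousLinearMap.apply ℂ CfLip F).map_tsum (summable_cfQδ_pow A hA h2)
  show (∑' n : ℕ, cfQδ A hA h2 ^ n) F = _
  simpa only [ContinuousLinearMap.apply_apply] using h

/-- Summability of `n ↦ Qⁿ F`. [folklore] -/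
theorem summable_cfQδ_pow_apply (F : CfLip) : Summable fun n : ℕ => (cfQδ A hA h2 ^ n) F := by
  have h := (summable_cfQδ_pow A hA h2).mapL (ContinuousLinearMap.apply ℂ CfLip F)
  simpa only [ContinuousLinearMap.apply_apply] using h

/-- **`ν ∘ R₀ = ν`.** [folklore] -/
theorem cfNuL_cfR0 (F : CfLip) : cfNuL A hA h2 (cfR0 A hA h2 F) = cfNuL A hA h2 F := by
  have hs := summable_cfQδ_pow_apply A hA h2 F
  rw [cfR0_apply, (cfNuL A hA h2).map_tsum hs, (hs.mapL (cfNuL A hA h2)).tsum_eq_zero_add]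
  simp only [pow_zero, ContinuousLinearMap.one_def, ContinuousLinearMap.coe_id', id_eq, cfNuL_cfQδ_pow_succ,
    tsum_zero, add_zero]

/-- **`R₀ h = h`.** [folklore] -/
theorem cfR0_cfHL : cfR0 A hA h2 (cfHL A hA h2) = cfHL A hA h2 := by
  have hs := summable_cfQδ_pow_apply A hA h2 (cfHL A hA h2)
  rw [cfR0_apply, hs.tsum_eq_zero_add]
  simp only [pow_zero, ContinuousLinearMap.one_def, ContinuousLinearMap.coe_id', id_eq, cfQδ_pow_succ_cfHL,
    tsum_zero, add_zero]

end Gap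

end Literature.NumberTheory.Sieve
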